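import Literature.NumberTheory.EllipticCurves.ToricTwoVariablePAdicLFunctionUpTo
import Literature.NumberTheory.EllipticCurves.IwasawaAlgebraTwoVarGeneratorChange
import Literature.NumberTheory.EllipticCurves.DeShalit1987.KatzMeasureFromDistribution
import Literature.NumberTheory.EllipticCurves.PadicSeriesEvaluation
import Summits.BirchSwinnertonDyer.Rank1Residual.X11b.Three.UnrSeriesTwistCharacter
import Mathlib.RingTheory.MvPowerSeries.Evaluation
import HarnessLib

/-!
# Values of two-variable `R₀`-series under the group-like frame substitution `φ_A`, I: evaluation, substitution and the
# frame images at character points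
# (helper on the rational wall `RationalSplitIMCInclusionAtThree`, item stmt-BirchSwinnertonDyer-24207, line `ratwall_thin_comb` v7;
# cell `pub/bsd-wall`, LEAD `cruxlead-24207` g6; `--supports stmt-BirchSwinnertonDyer-24207`)

WHY THIS FILE (LEAD-CENSUS-g5 §5 (h2), the last hand-sized kernel infrastructure named there). Both halves of the v7 stub
`stub_toricExistsSymmUpTo2` are statements about VALUES of a two-variable series `L₂ ∈ R₀⟦T₂⟧⟦T₁⟧` read in a generator pair
`(κ₁, κ₂; γ₁, γ₂)` of the `ℤ_p²`-tower AFTER a change of frame `φ_A = IwasawaAlgebra₂.frameSubst R₀ A` (`A ∈ GL₂(ℤ_p)`): (i) a typed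
source (Hao–Loeffler 2025, Thm. 3.5) will deliver the toric function in ITS frame, the line consumes it in the 𝔭-adapted frame;
(ii) the symmetry clause `φ_{A_τ} L₂ ∼ L₂` is read off the functional equation through the dictionary «value of `φ_{A_τ} L₂` at `ψ̂` =
value of `L₂` at `ψ̂ ∘ τ`». This file proves that dictionary in the kernel:

* §1 `𝓞_{ℂ_p}` as a target of Mathlib's topological evaluation `MvPowerSeries.eval₂` (complete, linearly topologised; pairs of points of
  the open unit polydisc are evaluable) and the generic compatibility **evaluation ∘ substitution = evaluation at the evaluated
  substitution** (`eval₂_subst`, Bourbaki A.IV §4 no. 3; both sides are continuous in the series and agree on polynomials).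
* §2 `UnrSeries.HasValueAt₂ L x y v` (the tree's value predicate, a `HasSum` over `ℕ × ℕ`) IS Mathlib's `eval₂` along
  `unrToInt : R₀ → 𝓞_{ℂ_p}` at points of `𝓞_{ℂ_p}` (`hasValueAt₂_eval₂`), and `φ_A` is the substitution of the frame images
  (`eval₂_frameSubst`).
* §3 At the point `(r(γ₁) − 1, r(γ₂) − 1)` of a character `r` through the pair, the frame image `(1+T₁)^{A 0 j}(1+T₂)^{A 1 j} − 1`
  takes the value `r(g_j) − 1` for ANY `g_j ∈ Γ_K` with additive coordinates `(κ₁ g_j, κ₂ g_j) =` column `j` of `A`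
  (`coe_eval₂_frameImages`; the `p`-adic exponent enters through the tree's `hasValueAt_binomialSeries_addChar` — continuity of
  `a ↦ Σ (a choose n) xⁿ` and density of `ℕ` in `ℤ_p` — and de Shalit's descended character `ZpExtension.pairChar`).
* The companion file `UniversalToricDescentThinCombFrameCovariance.lean` assembles these into the FRAME COVARIANCE of
  `UnrSeries.HasValueAt₂` (`(φ_A L)(r γ₁ − 1, r γ₂ − 1) = L(r g₁ − 1, r g₂ − 1)` for `A = frameMatrixOf κ₁ κ₂ g₁ g₂ id`) and of
  `IsToricTwoVarLFunctionUpTo₂` (a ♯♯-frame in one generator pair gives the ♯♯-frame `φ_A L₂` in any other pair of the tower).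

Pure `p`-adic analysis and bookkeeping; theorems only (no definition, no instance, no notation, no `sorry`); nothing about
elliptic curves is proved; BSD is not proved by any of this; 24207 stays OPEN.

References: Bourbaki, *Algebra* II, Ch. IV §4 no. 3 [cite: BourbakiAlgebraII2003, Ch. IV §4]; Washington §13.2 / §7.1
[cite: Washington1997, §13.2]; Neukirch–Schmidt–Wingberg (5.3.5) [cite: NeukirchSchmidtWingberg2008, (5.3.5)]; de Shalit II.4.17 (54)
[cite: deShalit1987, II.4.17 (54)]; Castella–Wan §2.4 Thm. 2.11 [cite: CastellaWan2023, §2.4 Thm. 2.11 (arXiv:1607.02019)];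
Hao–Loeffler Thm. 3.5 [cite: HaoLoeffler2025, Thm. 3.5 (arXiv:2405.12611)].
-/

set_option linter.dupNamespace false
set_option autoImplicit false

noncomputable section

open scoped MatrixGroups
open Filter Topology Field
open Literature.NumberTheory.EllipticCurves Literature.NumberTheory.IwasawaTheory
open Literature.NumberTheory.GaloisRepresentations

namespace Summit.BirchSwinnertonDyer.BirchSwinnertonDyer.Theorems.UniversalToricDescentThinComb.FrameValues

open Summit.BirchSwinnertonDyer.Rank1Residual.X11b.Halves

/-! ## §1 The target `𝓞_{ℂ_p}` of topological evaluation; evaluation commutes with substitution -/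

section Target

variable (p : ℕ) [Fact p.Prime]

/-- `𝓞_{ℂ_p}` is complete (the closed unit ball of the complete field `ℂ_p`). [cite: BourbakiAlgebraII2003, Ch. IV §4] -/
theorem completeSpace_padicComplexInt : CompleteSpace 𝓞_ℂ_[p] :=
  haveI : IsClosed ((𝓞_ℂ_[p] : ValuationSubring ℂ_[p]) : Set ℂ_[p]) := Valued.isClosed_valuationSubring ℂ_[p]
  IsClosed.completeSpace_coe

/-- `𝓞_{ℂ_p}` is linearly topologised: the open balls about `0` are ideals (ultrametric inequality and `‖a x‖ ≤ ‖x‖` for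
`‖a‖ ≤ 1`) and form a basis of neighbourhoods of `0` — the hypothesis of Mathlib's `MvPowerSeries.eval₂`.
[cite: BourbakiAlgebraII2003, Ch. IV §4] -/
theorem isLinearTopology_padicComplexInt : IsLinearTopology 𝓞_ℂ_[p] 𝓞_ℂ_[p] := by
  let I : ∀ r : ℝ, 0 < r → Ideal 𝓞_ℂ_[p] := fun r hr ↦
    { carrier := Metric.ball (0 : 𝓞_ℂ_[p]) r
      add_mem' := fun {x y} hx hy ↦ by
        rw [mem_ball_zero_iff] at hx hy ⊢
        exact (IsUltrametricDist.norm_add_le_max x y).trans_lt (max_lt hx hy)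
      zero_mem' := by
        rw [mem_ball_zero_iff, norm_zero]
        exact hr
      smul_mem' := fun a {x} hx ↦ by
        rw [mem_ball_zero_iff] at hx ⊢
        rw [smul_eq_mul]
        calc ‖a * x‖ ≤ ‖a‖ * ‖x‖ := norm_mul_le a x
          _ ≤ 1 * ‖x‖ := by
              gcongr
              exact norm_coe_padicComplexInt_le_one a
          _ = ‖x‖ := one_mul _
          _ < r := hx }
  let s : ℝ → Ideal 𝓞_ℂ_[p] := fun r ↦ if hr : 0 < r then I r hr else ⊤
  refine IsLinearTopology.mk_of_hasBasis' 𝓞_ℂ_[p] (S := Ideal 𝓞_ℂ_[p]) (p := fun r : ℝ ↦ 0 < r) (s := s) ?_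
    (fun J a m hm ↦ J.smul_mem a hm)
  refine (Metric.nhds_basis_ball (x := (0 : 𝓞_ℂ_[p]))).congr (fun _ ↦ Iff.rfl) fun r hr ↦ ?_
  simp only [s, dif_pos hr]
  rfl

variable {p}

/-- `‖tⁿ‖ = ‖t‖ⁿ` in `𝓞_{ℂ_p}` (the norm of `ℂ_p` is multiplicative). [cite: BourbakiAlgebraII2003, Ch. IV §4] -/
theorem norm_pow_padicComplexInt (t : 𝓞_ℂ_[p]) (n : ℕ) : ‖t ^ n‖ = ‖t‖ ^ n := by
  change ‖((t ^ n : 𝓞_ℂ_[p]) : ℂ_[p])‖ = ‖(t : ℂ_[p])‖ ^ n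
  rw [SubmonoidClass.coe_pow, norm_pow]

/-- An element of `𝓞_{ℂ_p}` of norm `< 1` is topologically nilpotent. [cite: BourbakiAlgebraII2003, Ch. IV §4] -/
theorem tendsto_pow_of_norm_lt_one {t : 𝓞_ℂ_[p]} (ht : ‖t‖ < 1) : Tendsto (fun n : ℕ ↦ t ^ n) atTop (𝓝 0) := by
  rw [tendsto_zero_iff_norm_tendsto_zero]
  simp_rw [norm_pow_padicComplexInt]
  exact tendsto_pow_atTop_nhds_zero_of_lt_one (norm_nonneg t) ht

/-- Finite families of points of the open unit disc of `𝓞_{ℂ_p}` are evaluable (`MvPowerSeries.HasEval`).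
[cite: BourbakiAlgebraII2003, Ch. IV §4] -/
theorem mvHasEval {τ : Type*} [Finite τ] {b : τ → 𝓞_ℂ_[p]} (hb : ∀ i, ‖b i‖ < 1) : MvPowerSeries.HasEval b where
  hpow i := tendsto_pow_of_norm_lt_one (hb i)
  tendsto_zero := by
    rw [(Filter.cofinite_eq_bot_iff.mpr ‹Finite τ›)]
    exact tendsto_bot

/-- The pair `(u, v)` of points of the open unit disc of `𝓞_{ℂ_p}` is evaluable. [cite: BourbakiAlgebraII2003, Ch. IV §4] -/
theorem hasEval_pair {u v : 𝓞_ℂ_[p]} (hu : ‖u‖ < 1) (hv : ‖v‖ < 1) : MvPowerSeries.HasEval ![u, v] :=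
  mvHasEval fun i ↦ by fin_cases i <;> assumption

/-- The coefficient embedding `unrToInt : R₀ → 𝓞_{ℂ_p}` is continuous (both carry the subspace topology of `ℂ_p`).
[cite: CastellaWan2023, §2.4 Thm. 2.11 (arXiv:1607.02019)] -/
theorem continuous_unrToInt : Continuous (unrToInt (p := p)) :=
  continuous_induced_rng.mpr continuous_subtype_val

end Target

section SubstCompat

open MvPowerSeries MvPowerSeries.WithPiTopology

variable {R : Type*} [CommRing R] [UniformSpace R] [IsTopologicalRing R] [IsUniformAddGroup R]
  {S : Type*} [CommRing S] [UniformSpace S] [IsUniformAddGroup S] [CompleteSpace S] [T2Space S]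
  [IsTopologicalRing S] [IsLinearTopology S S]
  {φ : R →+* S} {σ τ : Type*} {a : σ → MvPowerSeries τ R} {b : τ → S}

/-- **Evaluation commutes with substitution** (`(subst a f)(b) = f(a(b))`) for power series over a topological ring `R`
evaluated through a continuous `φ : R → S` into a complete, Hausdorff, linearly topologised `S`: both sides are continuous
in `f` (substitution is continuous for the product topology with ANY coefficient topology,
`mvPowerSeries_continuous_subst`) and agree on polynomials (Mathlib `MvPowerSeries.eval₂_unique`). The tree's
`padicInt_eval₂_subst` is the case `φ = id_{ℤ_p}`. [cite: BourbakiAlgebraII2003, Ch. IV §4] -/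
theorem eval₂_subst (hφ : Continuous φ) (ha : HasSubst a) (hb : MvPowerSeries.HasEval b) (f : MvPowerSeries σ R) :
    eval₂ φ b (subst a f) = eval₂ φ (fun s ↦ eval₂ φ b (a s)) f := by
  have hc : Continuous (eval₂Hom hφ hb) := by
    rw [MvPowerSeries.coe_eval₂Hom]
    exact continuous_eval₂ hφ hb
  have hb' : MvPowerSeries.HasEval fun s ↦ eval₂ φ b (a s) := by
    have := (ha.hasEval (S := R)).map hc
    rwa [MvPowerSeries.coe_eval₂Hom] at this
  have key := eval₂_unique hφ hb' (ε := fun f ↦ eval₂ φ b (subst a f))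
    ((continuous_eval₂ hφ hb).comp (mvPowerSeries_continuous_subst ha)) ?_
  · exact congr_fun key f
  · intro q
    rw [MvPowerSeries.subst_coe q]
    induction q using MvPolynomial.induction_on with
    | C r =>
      rw [MvPolynomial.aeval_C, MvPolynomial.eval₂_C, MvPowerSeries.algebraMap_apply, Algebra.algebraMap_self,
        RingHom.id_apply, MvPowerSeries.eval₂_C]
    | add f g hf hg =>
      rw [map_add, MvPolynomial.eval₂_add, ← hf, ← hg, ← MvPowerSeries.coe_eval₂Hom hφ hb, map_add]
    | mul_X f s hf =>
      rw [map_mul, MvPolynomial.aeval_X, MvPolynomial.eval₂_mul, MvPolynomial.eval₂_X, ← hf,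
        ← MvPowerSeries.coe_eval₂Hom hφ hb, map_mul]

/-- The one-variable-into-many case: `(f(T_i))(b) = f(b_i)` for `f ∈ R⟦X⟧` placed in the variable `i`
(`PowerSeries.toMvPowerSeries`). [cite: BourbakiAlgebraII2003, Ch. IV §4] -/
theorem eval₂_toMvPowerSeries (hφ : Continuous φ) (hb : MvPowerSeries.HasEval b) (i : τ) (f : PowerSeries R) :
    eval₂ φ b (PowerSeries.toMvPowerSeries i f) = PowerSeries.eval₂ φ (b i) f := by
  rw [PowerSeries.toMvPowerSeries_eq_subst, PowerSeries.subst,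
    eval₂_subst hφ (PowerSeries.HasSubst.const (PowerSeries.HasSubst.X i)) hb, MvPowerSeries.eval₂_X]
  rfl

end SubstCompat

/-! ## §2 `HasValueAt₂` is evaluation along `R₀ → 𝓞_{ℂ_p}`; `φ_A` is substitution of the frame images -/

section Values

variable {p : ℕ} [Fact p.Prime]

/-- **The value predicate is Mathlib's evaluation**: for `L ∈ R₀⟦T₂⟧⟦T₁⟧` and points `u, v ∈ 𝓞_{ℂ_p}` of norm `< 1`,
`L` has at `(u, v)` the value `eval₂ unrToInt (u, v) L` (read in `ℂ_p`; the series in the two-variable receptacle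
`nestedPowerSeriesEquiv L`, outer `T₁` = index `0`). [cite: CastellaWan2023, §2.4 Thm. 2.11 (arXiv:1607.02019)] [cite: deShalit1987, II.4.17 (54)] -/
theorem hasValueAt₂_eval₂ (L : PowerSeries (UnrSeries p)) {u v : 𝓞_ℂ_[p]} (hu : ‖u‖ < 1) (hv : ‖v‖ < 1) :
    haveI := completeSpace_padicComplexInt p
    haveI := isLinearTopology_padicComplexInt p
    UnrSeries.HasValueAt₂ L (u : ℂ_[p]) (v : ℂ_[p])
      ((MvPowerSeries.eval₂ (unrToInt (p := p)) ![u, v] (nestedPowerSeriesEquiv L) : 𝓞_ℂ_[p]) : ℂ_[p]) := by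
  haveI := completeSpace_padicComplexInt p
  haveI := isLinearTopology_padicComplexInt p
  have h := MvPowerSeries.hasSum_eval₂ (continuous_unrToInt (p := p)) (hasEval_pair hu hv)
    (nestedPowerSeriesEquiv L)
  have h' := h.map (PadicComplexInt p).subtype.toAddMonoidHom continuous_subtype_val
  unfold UnrSeries.HasValueAt₂
  have hfun : (fun k : ℕ × ℕ ↦ ((PowerSeries.coeff k.2 (PowerSeries.coeff k.1 L) : unrIntegers p) : ℂ_[p]) *
      (u : ℂ_[p]) ^ k.1 * (v : ℂ_[p]) ^ k.2) =
      ((PadicComplexInt p).subtype.toAddMonoidHom ∘ fun d : Fin 2 →₀ ℕ ↦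
        unrToInt (MvPowerSeries.coeff d (nestedPowerSeriesEquiv L)) * d.prod fun s e ↦ ![u, v] s ^ e) ∘
        MvPowerSeries.finTwoExponentEquiv := by
    funext k
    simp only [Function.comp_apply, MvPowerSeries.finTwoExponentEquiv_apply, finsupp_prod_pow_fin_two,
      coeff_nestedPowerSeriesEquiv, MvPowerSeries.finTwoExponent_apply_zero, MvPowerSeries.finTwoExponent_apply_one,
      Matrix.cons_val_zero, Matrix.cons_val_one, RingHom.toAddMonoidHom_eq_coe, AddMonoidHom.coe_coe,
      ValuationSubring.coe_subtype]
    push_cast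
    rw [coe_unrToInt, mul_assoc]
  rw [hfun, Equiv.hasSum_iff]
  exact h'

/-- **`φ_A` is substitution of the frame images, through evaluation**: the value of `φ_A L` at `(u, v)` is the value of `L`
at the evaluated frame images `((1+u)^{A 0 0}(1+v)^{A 1 0} − 1, (1+u)^{A 0 1}(1+v)^{A 1 1} − 1)` — the two-variable evaluation
law applied to `frameSubst = subst (frameImages A)`. [cite: NeukirchSchmidtWingberg2008, (5.3.5)] [cite: BourbakiAlgebraII2003, Ch. IV §4] -/
theorem eval₂_frameSubst (A : GL (Fin 2) ℤ_[p]) (L : PowerSeries (UnrSeries p)) {u v : 𝓞_ℂ_[p]} (hu : ‖u‖ < 1)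
    (hv : ‖v‖ < 1) :
    letI : Algebra ℤ_[p] (unrIntegers p) := (toUnr p).toAlgebra
    haveI := completeSpace_padicComplexInt p
    haveI := isLinearTopology_padicComplexInt p
    MvPowerSeries.eval₂ (unrToInt (p := p)) ![u, v]
        (nestedPowerSeriesEquiv (IwasawaAlgebra₂.frameSubst (unrIntegers p) A L)) =
      MvPowerSeries.eval₂ (unrToInt (p := p))
        (fun j ↦ MvPowerSeries.eval₂ (unrToInt (p := p)) ![u, v]
          (IwasawaAlgebra₂.frameImages (unrIntegers p) (A : Matrix (Fin 2) (Fin 2) ℤ_[p]) j))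
        (nestedPowerSeriesEquiv L) := by
  letI : Algebra ℤ_[p] (unrIntegers p) := (toUnr p).toAlgebra
  haveI := completeSpace_padicComplexInt p
  haveI := isLinearTopology_padicComplexInt p
  rw [IwasawaAlgebra₂.frameSubst_apply, IwasawaAlgebra₂.frameSubstRingHom_apply, RingEquiv.apply_symm_apply,
    IwasawaAlgebra₂.frameSubstMv_apply]
  exact eval₂_subst continuous_unrToInt (IwasawaAlgebra₂.hasSubst_frameImages _ _) (hasEval_pair hu hv) _

end Values

/-! ## §3 The frame images at the point of a character through the pair -/

section Point

variable {p : ℕ} [Fact p.Prime] {K : Type} [Field K] [NumberField K]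
  {κ₁ κ₂ : ZpExtension K p} {γ₁ γ₂ : absoluteGaloisGroup K} {r : FramedGaloisRep K (PadicAlgCl p) 1}

/-- `r(g) − 1 ∈ 𝓞_{ℂ_p}` for a character `r` through the pair (it has norm `< 1`). [cite: deShalit1987, II.4.17 (54)] -/
theorem avatarValueAt_sub_one_mem (hr : FactorsThroughPair κ₁ κ₂ r) (g : absoluteGaloisGroup K) :
    avatarValueAt r g - 1 ∈ 𝓞_ℂ_[p] :=
  mem_padicComplexInt_iff.mpr (norm_avatarValueAt_sub_one_lt_of_factorsThroughPair hr g).le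

/-- **`(1+T₁)^a` at the point `T₁ = r(γ₁) − 1` has the value `r̂(a, 0)`** (de Shalit's descended character
`pairChar` of `ℤ_p²` at `(a, 0)`; for `a ∈ ℕ` this is `r(γ₁)^a`, in general the continuous extension): Mathlib's evaluation of
`onePlusXPow 0 a` at `(u, v)`, `u = r(γ₁) − 1`, read in `ℂ_p`. [cite: deShalit1987, II.4.17 (54)] [cite: Washington1997, §13.2] -/
theorem coe_eval₂_onePlusXPow_zero (hpair : ZpExtension.IsTopGeneratorPair κ₁ κ₂ γ₁ γ₂)
    (hr : FactorsThroughPair κ₁ κ₂ r) (a : ℤ_[p]) {u v : 𝓞_ℂ_[p]} (hu : (u : ℂ_[p]) = avatarValueAt r γ₁ - 1)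
    (hu1 : ‖u‖ < 1) (hv1 : ‖v‖ < 1) :
    letI : Algebra ℤ_[p] (unrIntegers p) := (toUnr p).toAlgebra
    haveI := completeSpace_padicComplexInt p
    haveI := isLinearTopology_padicComplexInt p
    ((MvPowerSeries.eval₂ (unrToInt (p := p)) ![u, v] (IwasawaAlgebra₂.onePlusXPow (unrIntegers p) 0 a) :
        𝓞_ℂ_[p]) : ℂ_[p]) =
      ZpExtension.pairChar hpair.isIndependent r (a, 0) := by
  letI : Algebra ℤ_[p] (unrIntegers p) := (toUnr p).toAlgebra
  haveI := completeSpace_padicComplexInt p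
  haveI := isLinearTopology_padicComplexInt p
  have hind := hpair.isIndependent
  -- the additive character `a ↦ r̂(a, 0)` of `ℤ_p`
  let χ : AddChar ℤ_[p] ℂ_[p] :=
    { toFun := fun a ↦ ZpExtension.pairChar hind r (a, 0)
      map_zero_eq_one' := by
        change ZpExtension.pairChar hind r (0, 0) = 1
        rw [Prod.mk_zero_zero, ZpExtension.pairChar_zero hind hr]
      map_add_eq_mul' := fun a b ↦ by
        change ZpExtension.pairChar hind r (a + b, 0) = ZpExtension.pairChar hind r (a, 0) * ZpExtension.pairChar hind r (b, 0)
        rw [← ZpExtension.pairChar_add hind hr, Prod.mk_add_mk, add_zero] }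
  have hχc : Continuous χ :=
    (ZpExtension.continuous_pairChar hind hr).comp (continuous_id.prodMk continuous_const)
  have hχ1 : χ 1 = avatarValueAt r γ₁ := ZpExtension.pairChar_one_zero hr hpair hind
  -- the tree's value of `(1+T)^a` at `χ 1 − 1`
  have hval : UnrSeries.HasValueAt ((PowerSeries.binomialSeries ℤ_[p] a).map (toUnr p)) (χ 1 - 1) (χ a) :=
    hasValueAt_binomialSeries_addChar χ hχc a
  have hmap := IwasawaAlgebra₂.map_binomialSeries (unrIntegers p) a
  rw [RingHom.algebraMap_toAlgebra] at hmap
  rw [hχ1, ← hu, hmap] at hval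
  -- Mathlib's evaluation of the same one-variable series at `u`
  rw [IwasawaAlgebra₂.onePlusXPow_def, eval₂_toMvPowerSeries continuous_unrToInt (hasEval_pair hu1 hv1)]
  simp only [Matrix.cons_val_zero]
  have h1 := PowerSeries.hasSum_eval₂ (continuous_unrToInt (p := p))
    ((PowerSeries.hasEval_def _).mpr (tendsto_pow_of_norm_lt_one hu1)) (PowerSeries.binomialSeries (unrIntegers p) a)
  have h1' := h1.map (PadicComplexInt p).subtype.toAddMonoidHom continuous_subtype_val
  have hfun : ((PadicComplexInt p).subtype.toAddMonoidHom ∘ fun d : ℕ ↦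
      unrToInt (PowerSeries.coeff d (PowerSeries.binomialSeries (unrIntegers p) a)) * u ^ d) =
      fun d : ℕ ↦ ((PowerSeries.coeff d (PowerSeries.binomialSeries (unrIntegers p) a) : unrIntegers p) : ℂ_[p]) *
        (u : ℂ_[p]) ^ d := by
    funext d
    simp only [Function.comp_apply, RingHom.toAddMonoidHom_eq_coe, AddMonoidHom.coe_coe, ValuationSubring.coe_subtype]
    push_cast
    rw [coe_unrToInt]
  rw [hfun] at h1'
  exact HasSum.unique h1' hval

/-- **`(1+T₂)^c` at the point `T₂ = r(γ₂) − 1` has the value `r̂(0, c)`.** [cite: deShalit1987, II.4.17 (54)] [cite: Washington1997, §13.2] -/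
theorem coe_eval₂_onePlusXPow_one (hpair : ZpExtension.IsTopGeneratorPair κ₁ κ₂ γ₁ γ₂)
    (hr : FactorsThroughPair κ₁ κ₂ r) (c : ℤ_[p]) {u v : 𝓞_ℂ_[p]} (hv : (v : ℂ_[p]) = avatarValueAt r γ₂ - 1)
    (hu1 : ‖u‖ < 1) (hv1 : ‖v‖ < 1) :
    letI : Algebra ℤ_[p] (unrIntegers p) := (toUnr p).toAlgebra
    haveI := completeSpace_padicComplexInt p
    haveI := isLinearTopology_padicComplexInt p
    ((MvPowerSeries.eval₂ (unrToInt (p := p)) ![u, v] (IwasawaAlgebra₂.onePlusXPow (unrIntegers p) 1 c) :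
        𝓞_ℂ_[p]) : ℂ_[p]) =
      ZpExtension.pairChar hpair.isIndependent r (0, c) := by
  letI : Algebra ℤ_[p] (unrIntegers p) := (toUnr p).toAlgebra
  haveI := completeSpace_padicComplexInt p
  haveI := isLinearTopology_padicComplexInt p
  have hind := hpair.isIndependent
  let χ : AddChar ℤ_[p] ℂ_[p] :=
    { toFun := fun c ↦ ZpExtension.pairChar hind r (0, c)
      map_zero_eq_one' := by
        change ZpExtension.pairChar hind r (0, 0) = 1
        rw [Prod.mk_zero_zero, ZpExtension.pairChar_zero hind hr]
      map_add_eq_mul' := fun a b ↦ by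
        change ZpExtension.pairChar hind r (0, a + b) = ZpExtension.pairChar hind r (0, a) * ZpExtension.pairChar hind r (0, b)
        rw [← ZpExtension.pairChar_add hind hr, Prod.mk_add_mk, add_zero] }
  have hχc : Continuous χ :=
    (ZpExtension.continuous_pairChar hind hr).comp (continuous_const.prodMk continuous_id)
  have hχ1 : χ 1 = avatarValueAt r γ₂ := ZpExtension.pairChar_zero_one hr hpair hind
  have hval : UnrSeries.HasValueAt ((PowerSeries.binomialSeries ℤ_[p] c).map (toUnr p)) (χ 1 - 1) (χ c) :=
    hasValueAt_binomialSeries_addChar χ hχc c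
  have hmap := IwasawaAlgebra₂.map_binomialSeries (unrIntegers p) c
  rw [RingHom.algebraMap_toAlgebra] at hmap
  rw [hχ1, ← hv, hmap] at hval
  rw [IwasawaAlgebra₂.onePlusXPow_def, eval₂_toMvPowerSeries continuous_unrToInt (hasEval_pair hu1 hv1)]
  simp only [Matrix.cons_val_one, Matrix.cons_val_zero]
  have h1 := PowerSeries.hasSum_eval₂ (continuous_unrToInt (p := p))
    ((PowerSeries.hasEval_def _).mpr (tendsto_pow_of_norm_lt_one hv1)) (PowerSeries.binomialSeries (unrIntegers p) c)
  have h1' := h1.map (PadicComplexInt p).subtype.toAddMonoidHom continuous_subtype_val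
  have hfun : ((PadicComplexInt p).subtype.toAddMonoidHom ∘ fun d : ℕ ↦
      unrToInt (PowerSeries.coeff d (PowerSeries.binomialSeries (unrIntegers p) c)) * v ^ d) =
      fun d : ℕ ↦ ((PowerSeries.coeff d (PowerSeries.binomialSeries (unrIntegers p) c) : unrIntegers p) : ℂ_[p]) *
        (v : ℂ_[p]) ^ d := by
    funext d
    simp only [Function.comp_apply, RingHom.toAddMonoidHom_eq_coe, AddMonoidHom.coe_coe, ValuationSubring.coe_subtype]
    push_cast
    rw [coe_unrToInt]
  rw [hfun] at h1'
  exact HasSum.unique h1' hval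

/-- **The frame image `(1+T₁)^{A 0 j}(1+T₂)^{A 1 j} − 1` at the point `(r γ₁ − 1, r γ₂ − 1)` has the value `r(g) − 1` for
every `g ∈ Γ_K` whose additive coordinates in the pair are column `j` of `A`** (`κ₁ g = A 0 j`, `κ₂ g = A 1 j`): evaluation
is a ring homomorphism, the two binomial factors take the values `r̂(A 0 j, 0)`, `r̂(0, A 1 j)`, and `r̂` is a character with
`r̂ ∘ (κ₁, κ₂) = r`. [cite: deShalit1987, II.4.17 (54)] [cite: NeukirchSchmidtWingberg2008, (5.3.5)] -/
theorem coe_eval₂_frameImages (hpair : ZpExtension.IsTopGeneratorPair κ₁ κ₂ γ₁ γ₂)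
    (hr : FactorsThroughPair κ₁ κ₂ r) (A : Matrix (Fin 2) (Fin 2) ℤ_[p]) (j : Fin 2) (g : absoluteGaloisGroup K)
    (hg₁ : A 0 j = Multiplicative.toAdd (κ₁ g)) (hg₂ : A 1 j = Multiplicative.toAdd (κ₂ g))
    {u v : 𝓞_ℂ_[p]} (hu : (u : ℂ_[p]) = avatarValueAt r γ₁ - 1) (hv : (v : ℂ_[p]) = avatarValueAt r γ₂ - 1)
    (hu1 : ‖u‖ < 1) (hv1 : ‖v‖ < 1) :
    letI : Algebra ℤ_[p] (unrIntegers p) := (toUnr p).toAlgebra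
    haveI := completeSpace_padicComplexInt p
    haveI := isLinearTopology_padicComplexInt p
    ((MvPowerSeries.eval₂ (unrToInt (p := p)) ![u, v] (IwasawaAlgebra₂.frameImages (unrIntegers p) A j) :
        𝓞_ℂ_[p]) : ℂ_[p]) = avatarValueAt r g - 1 := by
  letI : Algebra ℤ_[p] (unrIntegers p) := (toUnr p).toAlgebra
  haveI := completeSpace_padicComplexInt p
  haveI := isLinearTopology_padicComplexInt p
  have hind := hpair.isIndependent
  rw [IwasawaAlgebra₂.frameImages_def, IwasawaAlgebra₂.frameMonomial_def,
    ← MvPowerSeries.coe_eval₂Hom continuous_unrToInt (hasEval_pair hu1 hv1), map_sub, map_mul, map_one,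
    MvPowerSeries.coe_eval₂Hom]
  push_cast
  rw [coe_eval₂_onePlusXPow_zero hpair hr (A 0 j) hu hu1 hv1, coe_eval₂_onePlusXPow_one hpair hr (A 1 j) hv hu1 hv1,
    ← ZpExtension.pairChar_add hind hr, Prod.mk_add_mk, add_zero, zero_add, hg₁, hg₂,
    ← ZpExtension.pairCoord_apply, ZpExtension.pairChar_pairCoord hind hr]

end Point

end Summit.BirchSwinnertonDyer.BirchSwinnertonDyer.Theorems.UniversalToricDescentThinComb.FrameValues

end
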